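import Mathlib
import HarnessLib
import Literature.MathematicalPhysics.StatisticalMechanics.PolymerProductBound

/-!
# The summed submultiplicativity estimate behind [ABKM19] Lemma 9.6 (the map `P₁`), abstract form:
# `|Σ_{X} Σ_{X₁⊆X} F₁^{U∖X} F₂^{X∖U} F₃^{X₁} G(X∖X₁)|_{T, w} ≤ Σ_X Σ_{X₁} a₁^{U∖X} a₂^{X∖U} a₃^{X₁} g(X∖X₁)`

[ABKM19] (9.x) ("uglyestimate"): for the reblocked sum
`P₁(I₁,I₂,J,K)(U) = Σ_{X : π(X) = U} I₁^{U∖X} I₂^{X∖U} Σ_{X₁ ⊆ X} J^{X₁} K̃(X∖X₁)`, Lemma 8.3 (iii)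
gives, term by term, `|·|_{k+1,U,T_φ} ≤ |||I₁|||^{|U∖X|} |||I₂|||^{|X∖U|} |||J|||^{|X₁|} ‖K̃(X₂)‖_{k:k+1,X₂}
· w_{k+1}^U(φ)` from the weight inequality `W_k^{U△X} W_k^{X₁} w_{k:k+1}^{X₂} ≤ w_{k+1}^U`.  We prove
this ABSTRACTLY, for any index family `𝓧` of `s`-polymers `X`, block functionals `F₁, F₂, F₃` with
per-block strong bounds `aᵢ(B)` (block gauges `T_B ≤ T`, weights `W^B`), a polymer functional `G` with
`|G(X₂)|_{T_{X₂}, wm^{X₂}} ≤ g(X₂)` and the weight inequality as a hypothesis — the form into which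
the torus tower's `StrongWeightStepP1.prod_strongWeight_sq_mul_midWeight_le_abkm` is plugged, both for
the zeroth-order bound of `K_{k+1}` and (with hybrid arguments) for its Lipschitz bound.

* **`tayNormLE_reblockTerm`** — one term `F₁^{U∖X} F₂^{X∖U} (F₃^{X₁} G(X∖X₁))`;
* **`tayNormLE_sum_reblockTerm`** — the double sum over `X ∈ 𝓧`, `X₁ ∈ 𝓟_s(X)`.

Everything is proved; no named fact.

## References
* S. Adams, S. Buchholz, R. Kotecký, S. Müller, arXiv:1910.13564, Lemma 9.6 (proof, first display),
  Lemma 8.3 (iii) [AdamsBuchholzKoteckyMuller2019].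
-/

noncomputable section

namespace Literature.MathematicalPhysics.StatisticalMechanics.GradientRG

open scoped BigOperators Classical
open Finset
open Literature.MathematicalPhysics.StatisticalMechanics.TorusPolymer (IsPolymer blocks polys bprod mem_polys)
open Literature.MathematicalPhysics.QuantumFieldTheory

variable {d M : ℕ} [NeZero M]
  {V : Type*} [NormedAddCommGroup V] [NormedSpace ℝ V]
  {Vb : Finset (Fin d → ZMod M) → Type*} [∀ B, NormedAddCommGroup (Vb B)] [∀ B, NormedSpace ℝ (Vb B)]
  {Vp : Finset (Fin d → ZMod M) → Type*} [∀ Y, NormedAddCommGroup (Vp Y)] [∀ Y, NormedSpace ℝ (Vp Y)]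

/-- **One reblocked term** ([ABKM19] Lemma 8.3 (iii)): for `s`-polymers `U, X` and `X₁ ⊆ X`, block
functionals `F₁, F₂, F₃` bounded on the blocks of `U ∖ X`, `X ∖ U`, `X₁` by `a₁, a₂, a₃ ≥ 0` in the block
norms `|·|_{T_B, W^B}` (`T_B ≤ T`, `C^{r₀}`, local), a functional `G` with `|G|_{T', wm} ≤ g` (`g ≥ 0`,
`T' ≤ T`) and the weight inequality `W^{U∖X} W^{X∖U} W^{X₁} wm ≤ w`:
`|F₁^{U∖X} F₂^{X∖U} (F₃^{X₁} G)|_{T, w} ≤ a₁^{U∖X} a₂^{X∖U} a₃^{X₁} g`.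
[cite: AdamsBuchholzKoteckyMuller2019, Lemma 8.3 (iii)] -/
theorem tayNormLE_reblockTerm (s : ℕ) (T : ((Fin d → ZMod M) → ℝ) →ₗ[ℝ] V)
    (Tb : ∀ B : Finset (Fin d → ZMod M), ((Fin d → ZMod M) → ℝ) →ₗ[ℝ] Vb B)
    {V' : Type*} [NormedAddCommGroup V'] [NormedSpace ℝ V'] (T' : ((Fin d → ZMod M) → ℝ) →ₗ[ℝ] V')
    {r₀ : ℕ} {W : Finset (Fin d → ZMod M) → ((Fin d → ZMod M) → ℝ) → ℝ}
    {wm w : ((Fin d → ZMod M) → ℝ) → ℝ}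
    {F₁ F₂ F₃ : Finset (Fin d → ZMod M) → ((Fin d → ZMod M) → ℝ) → ℂ}
    {G : ((Fin d → ZMod M) → ℝ) → ℂ} {a₁ a₂ a₃ : Finset (Fin d → ZMod M) → ℝ} {g : ℝ}
    (U X X₁ : Finset (Fin d → ZMod M))
    (hF₁ : ∀ B ∈ blocks s (U \ X), TayNormLE (Tb B) r₀ (W B) (F₁ B) (a₁ B))
    (hF₁d : ∀ B ∈ blocks s (U \ X), ContDiff ℝ r₀ (F₁ B))
    (hF₁loc : ∀ B ∈ blocks s (U \ X), IsGaugeLocal (Tb B) (F₁ B)) (ha₁ : ∀ B ∈ blocks s (U \ X), 0 ≤ a₁ B)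
    (hle₁ : ∀ B ∈ blocks s (U \ X), ∀ ξ, ‖Tb B ξ‖ ≤ ‖T ξ‖)
    (hF₂ : ∀ B ∈ blocks s (X \ U), TayNormLE (Tb B) r₀ (W B) (F₂ B) (a₂ B))
    (hF₂d : ∀ B ∈ blocks s (X \ U), ContDiff ℝ r₀ (F₂ B))
    (hF₂loc : ∀ B ∈ blocks s (X \ U), IsGaugeLocal (Tb B) (F₂ B)) (ha₂ : ∀ B ∈ blocks s (X \ U), 0 ≤ a₂ B)
    (hle₂ : ∀ B ∈ blocks s (X \ U), ∀ ξ, ‖Tb B ξ‖ ≤ ‖T ξ‖)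
    (hF₃ : ∀ B ∈ blocks s X₁, TayNormLE (Tb B) r₀ (W B) (F₃ B) (a₃ B))
    (hF₃d : ∀ B ∈ blocks s X₁, ContDiff ℝ r₀ (F₃ B))
    (hF₃loc : ∀ B ∈ blocks s X₁, IsGaugeLocal (Tb B) (F₃ B)) (ha₃ : ∀ B ∈ blocks s X₁, 0 ≤ a₃ B)
    (hle₃ : ∀ B ∈ blocks s X₁, ∀ ξ, ‖Tb B ξ‖ ≤ ‖T ξ‖)
    (hG : TayNormLE T' r₀ wm G g) (hGd : ContDiff ℝ r₀ G) (hGloc : IsGaugeLocal T' G) (hg : 0 ≤ g)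
    (hle' : ∀ ξ, ‖T' ξ‖ ≤ ‖T ξ‖)
    (hw : ∀ φ, (∏ B ∈ blocks s (U \ X), W B φ) * (∏ B ∈ blocks s (X \ U), W B φ) *
      ((∏ B ∈ blocks s X₁, W B φ) * wm φ) ≤ w φ) :
    TayNormLE T r₀ w
      (fun φ => bprod s (fun B => F₁ B φ) (U \ X) * bprod s (fun B => F₂ B φ) (X \ U) *
        (bprod s (fun B => F₃ B φ) X₁ * G φ))
      ((∏ B ∈ blocks s (U \ X), a₁ B) * (∏ B ∈ blocks s (X \ U), a₂ B) *
        ((∏ B ∈ blocks s X₁, a₃ B) * g)) := by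
  -- the three block products
  have h1 := tayNormLE_bprod s T Tb (U \ X) hF₁ hle₁ hF₁d hF₁loc ha₁
  have h2 := tayNormLE_bprod s T Tb (X \ U) hF₂ hle₂ hF₂d hF₂loc ha₂
  have h3 := tayNormLE_bprod s T Tb X₁ hF₃ hle₃ hF₃d hF₃loc ha₃
  have hcd : ∀ {F : Finset (Fin d → ZMod M) → ((Fin d → ZMod M) → ℝ) → ℂ} {Z : Finset (Fin d → ZMod M)},
      (∀ B ∈ blocks s Z, ContDiff ℝ r₀ (F B)) → ContDiff ℝ r₀ (fun φ => bprod s (fun B => F B φ) Z) := by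
    intro F Z hF
    unfold TorusPolymer.bprod
    exact contDiff_prod fun B hB => hF B hB
  have hlc : ∀ {F : Finset (Fin d → ZMod M) → ((Fin d → ZMod M) → ℝ) → ℂ} {Z : Finset (Fin d → ZMod M)},
      (∀ B ∈ blocks s Z, IsGaugeLocal (Tb B) (F B)) → (∀ B ∈ blocks s Z, ∀ ξ, ‖Tb B ξ‖ ≤ ‖T ξ‖) →
        IsGaugeLocal T (fun φ => bprod s (fun B => F B φ) Z) := by
    intro F Z hF hle
    unfold TorusPolymer.bprod
    exact IsGaugeLocal.prod _ fun B hB => (hF B hB).of_norm_le (hle B hB)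
  have hp1 : 0 ≤ ∏ B ∈ blocks s (U \ X), a₁ B := Finset.prod_nonneg ha₁
  have hp2 : 0 ≤ ∏ B ∈ blocks s (X \ U), a₂ B := Finset.prod_nonneg ha₂
  have hp3 : 0 ≤ ∏ B ∈ blocks s X₁, a₃ B := Finset.prod_nonneg ha₃
  -- `F₃^{X₁} G`
  have h3G := TayNormLE.mul (T := T) (w := fun φ => (∏ B ∈ blocks s X₁, W B φ) * wm φ) h3 hG
    (fun ξ => le_rfl) hle' (hcd hF₃d) hGd (hlc hF₃loc hle₃) hGloc hp3 hg (fun φ => le_rfl)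
  -- `F₁^{U∖X} F₂^{X∖U}`
  have h12 := TayNormLE.mul (T := T)
    (w := fun φ => (∏ B ∈ blocks s (U \ X), W B φ) * ∏ B ∈ blocks s (X \ U), W B φ) h1 h2
    (fun ξ => le_rfl) (fun ξ => le_rfl) (hcd hF₁d) (hcd hF₂d) (hlc hF₁loc hle₁) (hlc hF₂loc hle₂) hp1 hp2
    (fun φ => le_rfl)
  -- all together
  exact TayNormLE.mul (T := T) (w := w) h12 h3G (fun ξ => le_rfl) (fun ξ => le_rfl)
    ((hcd hF₁d).mul (hcd hF₂d)) ((hcd hF₃d).mul hGd)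
    ((hlc hF₁loc hle₁).mul (hlc hF₂loc hle₂)) ((hlc hF₃loc hle₃).mul (hGloc.of_norm_le hle'))
    (mul_nonneg hp1 hp2) (mul_nonneg hp3 hg) hw

/-- **The summed estimate** ([ABKM19] Lemma 9.6, first display): for a family `𝓧` of `s`-polymers,
block functionals bounded on a set of blocks `𝓑` containing all blocks of `U ∖ X`, `X ∖ U`, `X`
(`X ∈ 𝓧`), a polymer functional `G` bounded on the `X ∖ X₁` (`X ∈ 𝓧`, `X₁ ⊆ X`) in the norms
`|·|_{T_{X₂}, wm^{X₂}}`, and the weight inequality `W^{U∖X} W^{X∖U} W^{X₁} wm^{X∖X₁} ≤ w`: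
`|Σ_{X∈𝓧} Σ_{X₁∈𝓟_s(X)} F₁^{U∖X} F₂^{X∖U} F₃^{X₁} G(X∖X₁)|_{T,w}
  ≤ Σ_X Σ_{X₁} a₁^{U∖X} a₂^{X∖U} a₃^{X₁} g(X∖X₁)`.
[cite: AdamsBuchholzKoteckyMuller2019, Lemma 9.6 (proof, first display)] -/
theorem tayNormLE_sum_reblockTerm (s : ℕ) (T : ((Fin d → ZMod M) → ℝ) →ₗ[ℝ] V)
    (Tb : ∀ B : Finset (Fin d → ZMod M), ((Fin d → ZMod M) → ℝ) →ₗ[ℝ] Vb B)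
    (Tp : ∀ Y : Finset (Fin d → ZMod M), ((Fin d → ZMod M) → ℝ) →ₗ[ℝ] Vp Y) {r₀ : ℕ}
    {W wm : Finset (Fin d → ZMod M) → ((Fin d → ZMod M) → ℝ) → ℝ} {w : ((Fin d → ZMod M) → ℝ) → ℝ}
    {F₁ F₂ F₃ G : Finset (Fin d → ZMod M) → ((Fin d → ZMod M) → ℝ) → ℂ}
    {a₁ a₂ a₃ g : Finset (Fin d → ZMod M) → ℝ}
    (𝓧 𝓑 : Finset (Finset (Fin d → ZMod M))) (U : Finset (Fin d → ZMod M))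
    (h𝓑₁ : ∀ X ∈ 𝓧, blocks s (U \ X) ⊆ 𝓑) (h𝓑₂ : ∀ X ∈ 𝓧, blocks s (X \ U) ⊆ 𝓑)
    (h𝓑₃ : ∀ X ∈ 𝓧, blocks s X ⊆ 𝓑)
    (hle : ∀ B ∈ 𝓑, ∀ ξ, ‖Tb B ξ‖ ≤ ‖T ξ‖)
    (hF₁ : ∀ B ∈ 𝓑, TayNormLE (Tb B) r₀ (W B) (F₁ B) (a₁ B)) (hF₁d : ∀ B ∈ 𝓑, ContDiff ℝ r₀ (F₁ B))
    (hF₁loc : ∀ B ∈ 𝓑, IsGaugeLocal (Tb B) (F₁ B)) (ha₁ : ∀ B ∈ 𝓑, 0 ≤ a₁ B)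
    (hF₂ : ∀ B ∈ 𝓑, TayNormLE (Tb B) r₀ (W B) (F₂ B) (a₂ B)) (hF₂d : ∀ B ∈ 𝓑, ContDiff ℝ r₀ (F₂ B))
    (hF₂loc : ∀ B ∈ 𝓑, IsGaugeLocal (Tb B) (F₂ B)) (ha₂ : ∀ B ∈ 𝓑, 0 ≤ a₂ B)
    (hF₃ : ∀ B ∈ 𝓑, TayNormLE (Tb B) r₀ (W B) (F₃ B) (a₃ B)) (hF₃d : ∀ B ∈ 𝓑, ContDiff ℝ r₀ (F₃ B))
    (hF₃loc : ∀ B ∈ 𝓑, IsGaugeLocal (Tb B) (F₃ B)) (ha₃ : ∀ B ∈ 𝓑, 0 ≤ a₃ B)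
    (hG : ∀ X ∈ 𝓧, ∀ X₁ ∈ polys s X, TayNormLE (Tp (X \ X₁)) r₀ (wm (X \ X₁)) (G (X \ X₁)) (g (X \ X₁)))
    (hGd : ∀ X ∈ 𝓧, ∀ X₁ ∈ polys s X, ContDiff ℝ r₀ (G (X \ X₁)))
    (hGloc : ∀ X ∈ 𝓧, ∀ X₁ ∈ polys s X, IsGaugeLocal (Tp (X \ X₁)) (G (X \ X₁)))
    (hg : ∀ X ∈ 𝓧, ∀ X₁ ∈ polys s X, 0 ≤ g (X \ X₁))
    (hlep : ∀ X ∈ 𝓧, ∀ X₁ ∈ polys s X, ∀ ξ, ‖Tp (X \ X₁) ξ‖ ≤ ‖T ξ‖)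
    (hw : ∀ X ∈ 𝓧, ∀ X₁ ∈ polys s X, ∀ φ, (∏ B ∈ blocks s (U \ X), W B φ) *
      (∏ B ∈ blocks s (X \ U), W B φ) * ((∏ B ∈ blocks s X₁, W B φ) * wm (X \ X₁) φ) ≤ w φ) :
    TayNormLE T r₀ w
      (fun φ => ∑ X ∈ 𝓧, ∑ X₁ ∈ polys s X,
        bprod s (fun B => F₁ B φ) (U \ X) * bprod s (fun B => F₂ B φ) (X \ U) *
          (bprod s (fun B => F₃ B φ) X₁ * G (X \ X₁) φ))
      (∑ X ∈ 𝓧, ∑ X₁ ∈ polys s X, (∏ B ∈ blocks s (U \ X), a₁ B) * (∏ B ∈ blocks s (X \ U), a₂ B) *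
        ((∏ B ∈ blocks s X₁, a₃ B) * g (X \ X₁))) := by
  have hcd : ∀ {F : Finset (Fin d → ZMod M) → ((Fin d → ZMod M) → ℝ) → ℂ} {Z : Finset (Fin d → ZMod M)},
      (∀ B ∈ blocks s Z, ContDiff ℝ r₀ (F B)) → ContDiff ℝ r₀ (fun φ => bprod s (fun B => F B φ) Z) := by
    intro F Z hF
    unfold TorusPolymer.bprod
    exact contDiff_prod fun B hB => hF B hB
  refine TayNormLE.sum (T := T) (r₀ := r₀) (w := w) 𝓧 (fun X hX => ?_) (fun X hX => ?_)
  · refine TayNormLE.sum (T := T) (r₀ := r₀) (w := w) (polys s X) (fun X₁ hX₁ => ?_) (fun X₁ hX₁ => ?_)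
    · have h3sub : blocks s X₁ ⊆ 𝓑 := (TorusPolymer.blocks_mono s (mem_polys.1 hX₁).1).trans (h𝓑₃ X hX)
      exact tayNormLE_reblockTerm s T Tb (Tp (X \ X₁)) U X X₁
        (fun B hB => hF₁ B (h𝓑₁ X hX hB)) (fun B hB => hF₁d B (h𝓑₁ X hX hB))
        (fun B hB => hF₁loc B (h𝓑₁ X hX hB)) (fun B hB => ha₁ B (h𝓑₁ X hX hB))
        (fun B hB => hle B (h𝓑₁ X hX hB))
        (fun B hB => hF₂ B (h𝓑₂ X hX hB)) (fun B hB => hF₂d B (h𝓑₂ X hX hB))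
        (fun B hB => hF₂loc B (h𝓑₂ X hX hB)) (fun B hB => ha₂ B (h𝓑₂ X hX hB))
        (fun B hB => hle B (h𝓑₂ X hX hB))
        (fun B hB => hF₃ B (h3sub hB)) (fun B hB => hF₃d B (h3sub hB))
        (fun B hB => hF₃loc B (h3sub hB)) (fun B hB => ha₃ B (h3sub hB))
        (fun B hB => hle B (h3sub hB))
        (hG X hX X₁ hX₁) (hGd X hX X₁ hX₁) (hGloc X hX X₁ hX₁) (hg X hX X₁ hX₁) (hlep X hX X₁ hX₁)
        (hw X hX X₁ hX₁)
    · have h3sub : blocks s X₁ ⊆ 𝓑 := (TorusPolymer.blocks_mono s (mem_polys.1 hX₁).1).trans (h𝓑₃ X hX)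
      exact ((hcd fun B hB => hF₁d B (h𝓑₁ X hX hB)).mul (hcd fun B hB => hF₂d B (h𝓑₂ X hX hB))).mul
        ((hcd fun B hB => hF₃d B (h3sub hB)).mul (hGd X hX X₁ hX₁))
  · exact ContDiff.sum fun X₁ hX₁ => by
      have h3sub : blocks s X₁ ⊆ 𝓑 := (TorusPolymer.blocks_mono s (mem_polys.1 hX₁).1).trans (h𝓑₃ X hX)
      exact ((hcd fun B hB => hF₁d B (h𝓑₁ X hX hB)).mul (hcd fun B hB => hF₂d B (h𝓑₂ X hX hB))).mul
        ((hcd fun B hB => hF₃d B (h3sub hB)).mul (hGd X hX X₁ hX₁))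

end Literature.MathematicalPhysics.StatisticalMechanics.GradientRG

end
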